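import Mathlib
import HarnessLib

/-!
# Choosing a rational slope off finitely many short forbidden intervals

(Line `janus-bands`, crux `ArrangementNormalForm`, stub `stub_separateTwo`, part `Slopes`.)
The selection step of the planar GOOD-DIRECTION dissection (step 1 of the `stub_separateTwo`
roadmap; paper proof in the docstring of `…SeparateDirection`): the direction `v = (1, μ)` of a
piece must avoid finitely many rational slopes (the polar lines), finitely many short closed
slope intervals (the directions from the piece to the far crossing points, and the walls through
them), and the slopes of the tangent cone at the apex. If the forbidden closed intervals inside
the admissible slope window `(a, b)` have total length `< b − a`, a RATIONAL admissible slope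
exists (`exists_rat_slope`, registered as `separateTwo_slopes`): the complement is open
(finite union of closed intervals) and non-empty (Lebesgue measure), and `ℚ` is dense.
-/

noncomputable section

open Set MeasureTheory

namespace Summit.KontsevichZagierPeriods.ArrangementNormalForm.JanusBands

namespace SepTwo

/-- **A rational slope off finitely many short closed intervals.** -/
theorem exists_rat_slope {a b : ℝ} {n : ℕ} (lo hi : Fin n → ℝ)
    (hlh : ∀ i, lo i ≤ hi i) (hlen : ∑ i, (hi i - lo i) < b - a) :
    ∃ q : ℚ, a < q ∧ (q : ℝ) < b ∧ ∀ i, (q : ℝ) < lo i ∨ hi i < q := by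
  set U := Ioo a b \ ⋃ i, Icc (lo i) (hi i) with hU
  have hopen : IsOpen U :=
    isOpen_Ioo.sdiff (isClosed_iUnion_of_finite fun i => isClosed_Icc)
  have hne : U.Nonempty := by
    by_contra hemp
    rw [not_nonempty_iff_eq_empty, hU, sdiff_eq_empty] at hemp
    have h1 : volume (Ioo a b) ≤ ∑ i, volume (Icc (lo i) (hi i)) :=
      (measure_mono hemp).trans (measure_iUnion_fintype_le _ _)
    rw [Real.volume_Ioo] at h1
    simp only [Real.volume_Icc] at h1
    rw [← ENNReal.ofReal_sum_of_nonneg (fun i _ => sub_nonneg.2 (hlh i))] at h1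
    have h2 := (ENNReal.ofReal_le_ofReal_iff (Finset.sum_nonneg fun i _ => sub_nonneg.2 (hlh i))).1 h1
    linarith
  obtain ⟨q, hq⟩ := Rat.denseRange_cast.exists_mem_open hopen hne
  refine ⟨q, hq.1.1, hq.1.2, fun i => ?_⟩
  have hqi : (q : ℝ) ∉ Icc (lo i) (hi i) := fun h => hq.2 (mem_iUnion.2 ⟨i, h⟩)
  simp only [mem_Icc, not_and_or, not_le] at hqi
  exact hqi

end SepTwo

/-- **A rational slope off finitely many short closed intervals** (registered sub-goal of
`stub_separateTwo`; literal form of `SepTwo.exists_rat_slope`). -/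
theorem separateTwo_slopes (a b : ℝ) (n : ℕ) (lo hi : Fin n → ℝ) (hlh : ∀ i, lo i ≤ hi i) (hlen : ∑ i, (hi i - lo i) < b - a) : ∃ q : ℚ, a < q ∧ (q : ℝ) < b ∧ ∀ i, (q : ℝ) < lo i ∨ hi i < q := by
  exact SepTwo.exists_rat_slope lo hi hlh hlen

end Summit.KontsevichZagierPeriods.ArrangementNormalForm.JanusBands
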